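import Summits.CriticalPhenomena.CardyFormulaZ2.Theorems.CardyQContinuationFirstJetAtOneBounded
import Mathlib.Analysis.Complex.TaylorSeries

/-!
# Birth skeleton v2 — crux `UniformZeroFree` (stmt-CriticalPhenomena-5559) of route `CardyQContinuation`

Line `birth`/`registered`, RESHAPED by the lead (c1, 2026-08-17): "arc zero-freeness ⊕ uniform jets".
Notation of the route: for a conformal rectangle `R`, mesh `δ` and complex `s`,
`w_s(ω) = s^(|ω| + 2 k_B(ω))` is the self-dual arc weight of a bond configuration `ω ⊆ E(Ω_δ)` (arcs
`(ab)_δ ∪ (cd)_δ` jointly wired), `Z_δ(s) = Σ_ω w_s(ω)` the arc partition function,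
`N_δ(s) = Σ_{ω ∈ C_δ} w_s(ω)` its crossing-restricted part, `P_δ = N_δ/Z_δ` the crossing ratio and `T_ρ`
the complex `ρ`-neighbourhood of the real segment `s ∈ [1, √2]`.  The crux asks for `Z_δ ≠ 0` and
`‖P_δ‖ ≤ M` on `T_ρ`, uniformly in small `δ`.

* `stub_arcZeroFree` (statement unchanged; now written LET-FREE = the `dsimp only`-normal form of v1's `let w; let Z; …` form, so that the stub registry — which truncates at the first `:=` — records the full signature) — FISHER-ZERO CONTENT: `Z_δ ≠ 0` on `T_ρ`, δ-uniformly.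
* `stub_jetsBounded` (NEW, replaces `stub_oddsCone`) — AMPLITUDE CONTENT IN THE ROUTE'S OWN CURRENCY
  (jets at REAL points): there are `M, A` such that for all small `δ`, all real `t ∈ [1, √2]` and all
  `k`, `‖P_δ^{(k)}(t)‖ ≤ M · k! · A^k`.  The `k`-th `s`-jet of `log`-odds at a real point is the
  difference of the `k`-th CUMULANTS of `L = |ω| + 2k_B` under the critical FK measure `φ_{s=t}`
  conditioned on `C_δ` resp. on `C_δᶜ` (exponential family in `log s`); `k = 1` is exactly the route's
  canary items `FirstJetConverges` (stmt-5561, at `√2`) / `FirstJetAtOneBounded` (stmt-7102, at `1`):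
  `P′_δ = −P_δ(1−P_δ)·(E[L | C_δᶜ] − E[L | C_δ])/s`.  So this stub = "all-order, segment-wide FirstJet
  bounds with factorial growth" — a statement about REAL-parameter conditional covariances, attackable by
  RSW/coupling methods, unlike the complex-`s` cone.
* WHY THE RESHAPE: given `stub_arcZeroFree`, `stub_jetsBounded` is EQUIVALENT to the crux (⇐ below by
  Taylor expansion at real points, radius `min(ρ₁, 1/2A)`; ⇒ by Cauchy's estimates on discs of radius
  `ρ/2` inside `T_ρ`, landed separately as `UniformZeroFree.jetsBounded_of_uniformZeroFree`), whereas the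
  v1 stub `stub_oddsCone` (crossing-odds cone, worker verdict `stub-blocked: none`, no mechanism) is a
  strict strengthening.  v1's glue and the cone envelope remain valid and landed
  (`…Theorems.CardyQContinuationUniformZeroFreeOddsConeEnvelope/…Sector`, p144144/p144932); the arc
  envelope (pointwise-in-δ zero-freeness and pointwise crux) is `…UniformZeroFreeArcEnvelope` (p145864).
* Exact numerics (lead, kit j023079, certified root enclosures, 34 grids to 10×10 / 20×10 / 27×9): the
  only zeros of `Z_δ` within 2.414 of `[1, √2]` are `s = 0, −1`; conditional cumulant differences
  `Δκ_k`, `k ≤ 4`, stay O(1) and converge in `L` for squares (`Δκ₁ → ≈ −1.1`, `Δκ₂ → ≈ −0.13`,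
  `Δκ₃ ≈ −0.19`, `Δκ₄ ≈ −0.33` at `s = 1`), grow slowly with `L` at aspect 3 (`Lines/birth-numerics-A.md`).
* `UniformZeroFree_of : stub_arcZeroFree → stub_jetsBounded → UniformZeroFree` — the assembly (proved
  here, sorry-free): for `s ∈ T_ρ`, `ρ = min ρ₁ (1/(2(A+1)))`, pick real `t ∈ [1, √2]` with
  `|s − t| < ρ`; the disc `|z − t| < ρ₁` lies in `T_{ρ₁}` where `Z_δ ≠ 0`, so `P_δ` is holomorphic there
  and equals its Taylor series at `t` (`Complex.hasSum_taylorSeries_on_ball`); the jet bounds give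
  `‖P_δ(s)‖ ≤ Σ_k M (A|s−t|)^k ≤ 2M`.

Disproof used: none exists for this crux (no `Disproof.lean`, no `Negative/` lemma).  Dead lines: none.
Sources: Grimmett2006 §3.7 (self-dual weights, cumulant formulas Thm 3.12), arXiv:0905.2863 (normal
families from zero-freeness), arXiv:1702.02919 (continuum family analytic in `q`).
-/

namespace Summit.CriticalPhenomena.CardyFormulaZ2.Cruxes.UniformZeroFree.Birth

open Filter Set Metric
open scoped Topology Nat
open Summit.CriticalPhenomena.CardyFormulaZ2.Theorems.CardyQContinuation

/-- **stub 1 — arc zero-freeness** (Fisher-zero content of the crux): for every conformal rectangle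
there is `ρ > 0` such that for all small `δ > 0` the self-dual arc partition function
`Z_δ(s) = Σ_{ω ⊆ E(Ω_δ)} s^(|ω| + 2k_B(ω))` has no zero at complex `s` within `ρ` of `[1, √2]`.
Size XL / open (uniformity in `δ` is in no print source; Chang–Shrock cond-mat/0602178 for strips). -/
protected theorem Holds.stub_arcZeroFree :
    ∀ R : Literature.Probability.RandomPlanarGeometry.ConformalRectangle, ∃ ρ > (0:ℝ), ∀ᶠ δ in nhdsWithin (0:ℝ) (Set.Ioi 0), ∀ s ∈ Metric.thickening ρ (((↑) : ℝ → ℂ) '' Set.Icc (1:ℝ) (Real.sqrt 2)), (∑ᶠ ω ∈ 𝒫 (Literature.Probability.LatticeModels.discreteDomainGraph R.carrier δ).edgeSet, s ^ (ω.ncard + 2 * Nat.card ((Literature.Probability.Percolation.openGraph ω ⊔ Literature.Probability.LatticeModels.wired (Literature.Probability.LatticeModels.discreteArc R.carrier δ (R.arc 0) ∪ Literature.Probability.LatticeModels.discreteArc R.carrier δ (R.arc 2))).induce (Literature.Probability.LatticeModels.meshDomain R.carrier δ)).ConnectedComponent)) ≠ 0 := by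
  sorry

/-- By-name handle of the registered stub `Holds.stub_arcZeroFree` (device D-0027 §3.3: the hypotheses of
`UniformZeroFree_of` are these handles, by name). -/
def stub_arcZeroFree : Prop := type_of% Holds.stub_arcZeroFree

/-- **stub 2 — uniform jets at real points** (amplitude content of the crux, in jet form): for every
conformal rectangle there are `M, A` (with `A ≥ 0`) such that for all small `δ > 0`, every real
`t ∈ [1, √2]` and every order `k`, the `k`-th complex derivative of the crossing ratio
`P_δ = N_δ/Z_δ` at `t` has norm at most `M · k! · A^k`.  (`k = 0`: `‖P_δ(t)‖ ≤ M`, true with `M = 1`;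
`k = 1`: the route's FirstJet canaries, segment-wide; general `k`: the `k`-th jet of `log`-odds is the
difference of the `k`-th conditional cumulants of `L = |ω| + 2k_B` given `C_δᶜ` and `C_δ` under the
critical FK measure at `s = t`.)  Size XL / open. -/
protected theorem Holds.stub_jetsBounded :
    ∀ R : Literature.Probability.RandomPlanarGeometry.ConformalRectangle, ∃ M A : ℝ, 0 ≤ A ∧ ∀ᶠ δ in nhdsWithin (0:ℝ) (Set.Ioi 0), ∀ t ∈ Set.Icc (1:ℝ) (Real.sqrt 2), ∀ k : ℕ, ‖iteratedDeriv k (fun s ↦ (∑ᶠ ω ∈ 𝒫 (Literature.Probability.LatticeModels.discreteDomainGraph R.carrier δ).edgeSet, (Literature.Probability.Percolation.discreteCrossing R.carrier δ (R.arc 0) (R.arc 2)).indicator (fun ω ↦ s ^ (ω.ncard + 2 * Nat.card ((Literature.Probability.Percolation.openGraph ω ⊔ Literature.Probability.LatticeModels.wired (Literature.Probability.LatticeModels.discreteArc R.carrier δ (R.arc 0) ∪ Literature.Probability.LatticeModels.discreteArc R.carrier δ (R.arc 2))).induce (Literature.Probability.LatticeModels.meshDomain R.carrier δ)).ConnectedComponent))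 ω) / (∑ᶠ ω ∈ 𝒫 (Literature.Probability.LatticeModels.discreteDomainGraph R.carrier δ).edgeSet, s ^ (ω.ncard + 2 * Nat.card ((Literature.Probability.Percolation.openGraph ω ⊔ Literature.Probability.LatticeModels.wired (Literature.Probability.LatticeModels.discreteArc R.carrier δ (R.arc 0) ∪ Literature.Probability.LatticeModels.discreteArc R.carrier δ (R.arc 2))).induce (Literature.Probability.LatticeModels.meshDomain R.carrier δ)).ConnectedComponent))) (t : ℂ)‖ ≤ M * (k.factorial : ℝ) * A ^ k := by
  sorry

/-- By-name handle of the registered stub `Holds.stub_jetsBounded`. -/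
def stub_jetsBounded : Prop := type_of% Holds.stub_jetsBounded

/-- **Taylor bound from factorially bounded jets.** If `f` is complex differentiable on the disc
`|z − t| < R`, its jets at `t` satisfy `‖f^{(k)}(t)‖ ≤ M · k! · A^k` (`M, A ≥ 0`), and `s` lies in the
disc with `A · |s − t| ≤ 1/2`, then `‖f(s)‖ ≤ 2M` (sum the Taylor series,
`Complex.hasSum_taylorSeries_on_ball`, against the geometric series `M Σ 2^{-k}`). [folklore] -/
theorem norm_le_of_jets {f : ℂ → ℂ} {t : ℂ} {R M A : ℝ} (hf : DifferentiableOn ℂ f (Metric.ball t R))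
    (hM : 0 ≤ M) (hA : 0 ≤ A) (hj : ∀ k : ℕ, ‖iteratedDeriv k f t‖ ≤ M * (k.factorial : ℝ) * A ^ k)
    {s : ℂ} (hs : s ∈ Metric.ball t R) (hsA : A * ‖s - t‖ ≤ 1 / 2) : ‖f s‖ ≤ 2 * M := by
  have hsum := Complex.hasSum_taylorSeries_on_ball hf hs
  have hgeo : HasSum (fun k : ℕ ↦ M * (1 / 2 : ℝ) ^ k) (M * (1 - 1 / 2)⁻¹) :=
    (hasSum_geometric_of_lt_one (by norm_num) (by norm_num)).mul_left M
  have h2 : M * (1 - 1 / 2 : ℝ)⁻¹ = 2 * M := by norm_num; ring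
  rw [← h2]
  refine hsum.norm_le_of_bounded hgeo fun k ↦ ?_
  rw [norm_smul, norm_smul, norm_inv, Complex.norm_natCast, norm_pow]
  have hk : (0 : ℝ) < k.factorial := by exact_mod_cast k.factorial_pos
  have hst : 0 ≤ A * ‖s - t‖ := mul_nonneg hA (norm_nonneg _)
  calc (k.factorial : ℝ)⁻¹ * (‖s - t‖ ^ k * ‖iteratedDeriv k f t‖)
      ≤ (k.factorial : ℝ)⁻¹ * (‖s - t‖ ^ k * (M * (k.factorial : ℝ) * A ^ k)) := by
        gcongr
        exact hj k
    _ = M * (A * ‖s - t‖) ^ k := by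
        rw [mul_pow]; field_simp
    _ ≤ M * (1 / 2) ^ k := by
        gcongr

/-- Points of the disc of radius `r` about a real point `t ∈ [1, √2]` lie in the thickening `T_r`.
[folklore] -/
theorem ball_ofReal_subset_thickening {t : ℝ} (ht : t ∈ Set.Icc (1:ℝ) (Real.sqrt 2)) (r : ℝ) :
    Metric.ball (t : ℂ) r ⊆ Metric.thickening r (((↑) : ℝ → ℂ) '' Set.Icc (1:ℝ) (Real.sqrt 2)) := by
  intro s hs
  rw [Metric.mem_thickening_iff]
  exact ⟨(t : ℂ), ⟨t, ht, rfl⟩, hs⟩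

/-- A point of `T_ρ` is within `ρ` of some real `t ∈ [1, √2]`. [folklore] -/
theorem exists_real_near_of_mem_thickening {ρ : ℝ} {s : ℂ}
    (hs : s ∈ Metric.thickening ρ (((↑) : ℝ → ℂ) '' Set.Icc (1:ℝ) (Real.sqrt 2))) :
    ∃ t ∈ Set.Icc (1:ℝ) (Real.sqrt 2), dist s (t : ℂ) < ρ := by
  rw [Metric.mem_thickening_iff] at hs
  obtain ⟨_, ⟨t, ht, rfl⟩, hst⟩ := hs
  exact ⟨t, ht, hst⟩

/-- The crossing ratio `N/Z = (Σ_S 𝟙_C s^{m a}) / (Σ_S s^{m a})` (finite `S`) is holomorphic on any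
set where the denominator does not vanish. [folklore] -/
theorem differentiableOn_ratio {α : Type*} {S : Set α} (hS : S.Finite) (C : Set α) (m : α → ℕ)
    {U : Set ℂ} (hZ : ∀ z ∈ U, (∑ᶠ a ∈ S, z ^ m a) ≠ 0) :
    DifferentiableOn ℂ
      (fun z : ℂ => (∑ᶠ a ∈ S, C.indicator (fun b => z ^ m b) a) / ∑ᶠ a ∈ S, z ^ m a) U := by
  intro z hz
  have hN : Differentiable ℂ (fun z : ℂ => ∑ᶠ a ∈ S, C.indicator (fun b => z ^ m b) a) :=
    differentiable_finsum_mem hS fun a => differentiable_indicator_pow C m a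
  have hD : Differentiable ℂ (fun z : ℂ => ∑ᶠ a ∈ S, z ^ m a) :=
    differentiable_finsum_mem hS fun a => differentiable_pow (m a)
  exact ((hN z).div (hD z) (hZ z hz)).differentiableWithinAt

/-- **Assembly of the line, v2** (kernel-checked, no `sorry`): arc zero-freeness and uniform real jets
give the crux `UniformZeroFree` BY NAME, with `ρ = min ρ₁ (1/(2(A+1)))` and bound `2M`. -/
theorem UniformZeroFree_of :
    stub_arcZeroFree → stub_jetsBounded → Summit.CriticalPhenomena.CardyFormulaZ2.Theses.CardyQContinuation.UniformZeroFree := by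
  intro h1 h2
  dsimp only [stub_arcZeroFree, stub_jetsBounded] at h1 h2
  dsimp only [Summit.CriticalPhenomena.CardyFormulaZ2.Theses.CardyQContinuation.UniformZeroFree]
  intro R
  obtain ⟨ρ₁, hρ₁, h1R⟩ := h1 R
  obtain ⟨M, A, hA, h2R⟩ := h2 R
  have hA1 : 0 < 2 * (A + 1) := by positivity
  set ρ : ℝ := min ρ₁ (1 / (2 * (A + 1))) with hρdef
  have hρ : 0 < ρ := lt_min hρ₁ (by positivity)
  refine ⟨ρ, hρ, 2 * M, ?_⟩
  have hpos : ∀ᶠ δ in 𝓝[>] (0 : ℝ), 0 < δ := self_mem_nhdsWithin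
  filter_upwards [h1R, h2R, hpos] with δ hδ1 hδ2 hδpos
  intro s hs
  have hs1 : s ∈ Metric.thickening ρ₁ (((↑) : ℝ → ℂ) '' Set.Icc (1:ℝ) (Real.sqrt 2)) :=
    Metric.thickening_mono (min_le_left _ _) _ hs
  refine ⟨hδ1 s hs1, ?_⟩
  -- a real base point `t` within `ρ` of `s`
  obtain ⟨t, ht, hst⟩ := exists_real_near_of_mem_thickening hs
  -- `M ≥ 0` from the jet bound at order 0
  have hM : 0 ≤ M := by
    have h := hδ2 t ht 0
    simp only [Nat.factorial_zero, Nat.cast_one, mul_one, pow_zero] at h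
    exact (norm_nonneg _).trans h
  -- `P_δ` is holomorphic on the disc `|z - t| < ρ₁ ⊆ T_ρ₁` (no zero of `Z_δ` there)
  have hfin := finite_powerset_edgeSet R.isBounded hδpos
  have hdiff := differentiableOn_ratio hfin
    (Literature.Probability.Percolation.discreteCrossing R.carrier δ (R.arc 0) (R.arc 2))
    (fun ω ↦ ω.ncard + 2 * Nat.card ((Literature.Probability.Percolation.openGraph ω ⊔
      Literature.Probability.LatticeModels.wired
        (Literature.Probability.LatticeModels.discreteArc R.carrier δ (R.arc 0) ∪
          Literature.Probability.LatticeModels.discreteArc R.carrier δ (R.arc 2))).induce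
      (Literature.Probability.LatticeModels.meshDomain R.carrier δ)).ConnectedComponent)
    (U := Metric.ball (t : ℂ) ρ₁) fun z hz => hδ1 z (ball_ofReal_subset_thickening ht ρ₁ hz)
  have hsball : s ∈ Metric.ball (t : ℂ) ρ₁ :=
    Metric.mem_ball.2 (hst.trans_le (min_le_left _ _))
  have hsA : A * ‖s - (t : ℂ)‖ ≤ 1 / 2 := by
    have hst' : ‖s - (t : ℂ)‖ < 1 / (2 * (A + 1)) := by
      rw [← dist_eq_norm]; exact hst.trans_le (min_le_right _ _)
    have hA' : A * ‖s - (t : ℂ)‖ ≤ A * (1 / (2 * (A + 1))) :=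
      mul_le_mul_of_nonneg_left hst'.le hA
    have hfrac : A * (1 / (2 * (A + 1))) ≤ 1 / 2 := by
      rw [mul_one_div, div_le_div_iff₀ hA1 two_pos]
      nlinarith
    exact hA'.trans hfrac
  exact norm_le_of_jets hdiff hM hA (hδ2 t ht) hsball hsA

/-- **The crux BY NAME from the two stubs** (depends on `sorryAx` ONLY through `Holds.stub_arcZeroFree` and
`Holds.stub_jetsBounded`). -/
theorem UniformZeroFree_proof : Summit.CriticalPhenomena.CardyFormulaZ2.Theses.CardyQContinuation.UniformZeroFree :=
  UniformZeroFree_of Holds.stub_arcZeroFree Holds.stub_jetsBounded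

end Summit.CriticalPhenomena.CardyFormulaZ2.Cruxes.UniformZeroFree.Birth
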